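import Literature.RepresentationTheory.KonnoKonno2007.RealUnitaryRankOneKAK
import HarnessLib

/-!
# The stabiliser of the `β`-frame in `U(α,β)`: `β`-columns of `1` force `g = diag(u, 1)` — general `β`

Topic `RepresentationTheory/KonnoKonno2007`; namespace `Literature.RepresentationTheory.KonnoKonno2007.RealDualPair`.
KERNEL ONLY: 0 records, 0 `Prop`-valued definitions, 0 hypotheses beyond the statements; every statement is a kernel fact
about the explicit matrices of `RealUnitaryDualPair`; statements are steps of the Cartan decomposition of `U(p,q)`
[Knapp2002, I §1 Example (3), VII §3 Thm. 7.39] and carry that locator.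

Setting (`RealUnitaryDualPair`, `RealUnitaryRankOneKAK`): `UForm α β = U(α,β)` is the unitary group of the hermitian form
`diag(1_α, −1_β)` on `ℂ^{α ⊕ β}`, `UForm.kV : U(α) × U(β) →* U(α,β)` its block-diagonal maximal compact subgroup.
★ `RealUnitaryRankOneKAK.exists_eq_kV_of_col_eq` proves, for `|β| = 1` only (`[Subsingleton β]`), that an element of
`U(α,β)` whose `q₀`-column is `e_{q₀}` is `diag(u, 1)`.  This file removes the rank-one restriction: for ANY finite `β`,

* `exists_eq_kV_of_inr_cols_eq` — if every `β`-column of `h ∈ U(α,β)` is the corresponding column of `1`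
  (`h_{a,b} = 0` for `a ∈ α`, `h_{b,b'} = δ_{b b'}`), then `h = kV (u, 1)` for some `u ∈ U(α)`;
* `exists_eq_kV_of_inr_cols_eq_one` — the same with the hypothesis phrased on whole columns,
  `∀ i b, h_{i, inr b} = 1_{i, inr b}`;
* `kV_one_apply_inr` — conversely the `β`-columns of `kV (u, 1)` are those of `1`.

Proof (as in the rank-one file): from the defining identity `hᴴ J h = J` by entries (★ `UForm.form_apply`), the
`(inr b, inl a')` entries kill the bottom-left block and the `(inl a₁, inl a₂)` entries make the `α`-block unitary; the
four blocks then assemble to `fromBlocks u 0 0 1 = kV (u, 1)` (★ `UForm.coe_kV`).  It is the stabiliser step of the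
`KAK` decomposition of `U(α,β)` in real rank `|β| ≥ 2` (consumer: `RealUnitaryRankTwoKAK`, K2E2-p12 (g3), KAK-U22).

Provenance (statement shape only; nothing is cited as a hypothesis): the stabiliser of a maximal negative-definite
frame in `U(p,q)` is `U(p) × 1` — e.g. [Knapp2002, §VI.2, Thm. 7.39 context]; elementary matrix algebra here.

BOUNDARY.  Imports only `RealUnitaryRankOneKAK` (tree) and Mathlib through it; introduces no record, no `Prop`
definition and no cited fact; a reproduction-side kernel leaf about explicit matrix groups.
-/

set_option autoImplicit false

noncomputable section

open Matrix Complex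
open scoped ComplexConjugate

namespace Literature.RepresentationTheory.KonnoKonno2007

namespace RealDualPair

open Literature.NumberTheory.Automorphic Literature.NumberTheory.Automorphic.UnitaryGroup

section Stabiliser

variable {α β : Type*} [Fintype α] [DecidableEq α] [Fintype β] [DecidableEq β]

/-- **the stabiliser of the `β`-frame is `U(α) × 1`** (any finite `β`): an element of `U(α,β)` whose `β`-columns are
those of `1` — `h_{a, b} = 0` (`a ∈ α`) and `h_{b, b'} = δ_{b b'}` — is `diag(u, 1)` with `u ∈ U(α)`.  (From `hᴴ J h = J`:
the `(b, a')` entries kill the bottom-left block, the `(a₁, a₂)` entries make the `α`-block unitary.)  Generalises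
★ `exists_eq_kV_of_col_eq` (`|β| = 1`). [cite: Knapp2002, I §1 Example (3), VII §3 Thm. 7.39] -/
theorem exists_eq_kV_of_inr_cols_eq (h : UForm α β)
    (h1 : ∀ (a : α) (b : β), (((h : UForm α β) : GL (α ⊕ β) ℂ) : Matrix (α ⊕ β) (α ⊕ β) ℂ) (Sum.inl a) (Sum.inr b) = 0)
    (h2 : ∀ b b' : β, (((h : UForm α β) : GL (α ⊕ β) ℂ) : Matrix (α ⊕ β) (α ⊕ β) ℂ) (Sum.inr b) (Sum.inr b') =
      (1 : Matrix β β ℂ) b b') :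
    ∃ u : Matrix.unitaryGroup α ℂ, h = UForm.kV α β (u, 1) := by
  set M := (((h : UForm α β) : GL (α ⊕ β) ℂ) : Matrix (α ⊕ β) (α ⊕ β) ℂ) with hM
  -- bottom-left block: the `(inr b, inl a')` entry of `Mᴴ J M = J` reads `0 − M_{inr b, inl a'} = 0`
  have hrow : ∀ (b : β) (a' : α), M (Sum.inr b) (Sum.inl a') = 0 := fun b a' => by
    have e := UForm.form_apply h (Sum.inr b) (Sum.inl a')
    simp only [← hM, h1, star_zero, zero_mul, Finset.sum_const_zero, zero_sub, Matrix.fromBlocks_apply₂₁,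
      Matrix.zero_apply, neg_eq_zero, h2, Matrix.one_apply] at e
    rw [Finset.sum_eq_single b (fun b'' _ hb'' => by rw [if_neg hb'', star_zero, zero_mul])
      (fun hb => absurd (Finset.mem_univ b) hb), if_pos rfl, star_one, one_mul] at e
    exact e
  -- the `α`-block is unitary: the `(inl a₁, inl a₂)` entry of `Mᴴ J M = J` reads `(AᴴA)_{a₁a₂} − 0 = δ`
  let A : Matrix α α ℂ := fun a a' => M (Sum.inl a) (Sum.inl a')
  have hA : A ∈ Matrix.unitaryGroup α ℂ := by
    rw [Matrix.mem_unitaryGroup_iff']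
    ext a₁ a₂
    have e := UForm.form_apply h (Sum.inl a₁) (Sum.inl a₂)
    simp only [← hM, hrow, star_zero, zero_mul, Finset.sum_const_zero, sub_zero, Matrix.fromBlocks_apply₁₁] at e
    rw [Matrix.mul_apply]
    exact e
  refine ⟨⟨A, hA⟩, Subtype.ext (Units.ext ?_)⟩
  change M = (((UForm.kV α β (⟨A, hA⟩, 1) : UForm α β) : GL (α ⊕ β) ℂ) : Matrix (α ⊕ β) (α ⊕ β) ℂ)
  rw [UForm.coe_kV]
  ext i j
  rcases i with a | b <;> rcases j with a' | b'
  · rfl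
  · rw [Matrix.fromBlocks_apply₁₂, Matrix.zero_apply, h1]
  · rw [Matrix.fromBlocks_apply₂₁, Matrix.zero_apply, hrow]
  · rw [Matrix.fromBlocks_apply₂₂, OneMemClass.coe_one, h2]

/-- **the stabiliser of the `β`-frame is `U(α) × 1`**, whole-column phrasing: if the `β`-columns of `h ∈ U(α,β)` agree
with those of the identity matrix, `h = diag(u, 1)` with `u ∈ U(α)`. [cite: Knapp2002, I §1 Example (3), VII §3 Thm. 7.39] -/
theorem exists_eq_kV_of_inr_cols_eq_one (h : UForm α β)
    (hcol : ∀ (i : α ⊕ β) (b : β), (((h : UForm α β) : GL (α ⊕ β) ℂ) : Matrix (α ⊕ β) (α ⊕ β) ℂ) i (Sum.inr b) =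
      (1 : Matrix (α ⊕ β) (α ⊕ β) ℂ) i (Sum.inr b)) :
    ∃ u : Matrix.unitaryGroup α ℂ, h = UForm.kV α β (u, 1) := by
  refine exists_eq_kV_of_inr_cols_eq h (fun a b => ?_) (fun b b' => ?_)
  · rw [hcol, Matrix.one_apply_ne (Sum.inl_ne_inr)]
  · rw [hcol, Matrix.one_apply, Matrix.one_apply]
    simp only [Sum.inr.injEq]

/-- conversely, **the `β`-columns of `kV (u, 1) = diag(u, 1)` are those of `1`**. [cite: Knapp2002, I §1 Example (3), VII §3 Thm. 7.39] -/
theorem kV_one_apply_inr (u : Matrix.unitaryGroup α ℂ) (i : α ⊕ β) (b : β) :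
    (((UForm.kV α β (u, 1) : UForm α β) : GL (α ⊕ β) ℂ) : Matrix (α ⊕ β) (α ⊕ β) ℂ) i (Sum.inr b) =
      (1 : Matrix (α ⊕ β) (α ⊕ β) ℂ) i (Sum.inr b) := by
  rw [UForm.coe_kV]
  rcases i with a | b'
  · rw [Matrix.fromBlocks_apply₁₂, Matrix.zero_apply, Matrix.one_apply_ne (Sum.inl_ne_inr)]
  · rw [Matrix.fromBlocks_apply₂₂, OneMemClass.coe_one, Matrix.one_apply, Matrix.one_apply]
    simp only [Sum.inr.injEq]

/-- **stabiliser, product form**: if `g, g' ∈ U(α,β)` have the same `β`-columns then `g = g' · kV (u, 1)` for some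
`u ∈ U(α)` (apply `exists_eq_kV_of_inr_cols_eq_one` to `g'⁻¹ g`). [cite: Knapp2002, I §1 Example (3), VII §3 Thm. 7.39] -/
theorem exists_eq_mul_kV_of_inr_cols_eq (g g' : UForm α β)
    (hcol : ∀ (i : α ⊕ β) (b : β), (((g : UForm α β) : GL (α ⊕ β) ℂ) : Matrix (α ⊕ β) (α ⊕ β) ℂ) i (Sum.inr b) =
      (((g' : UForm α β) : GL (α ⊕ β) ℂ) : Matrix (α ⊕ β) (α ⊕ β) ℂ) i (Sum.inr b)) :
    ∃ u : Matrix.unitaryGroup α ℂ, g = g' * UForm.kV α β (u, 1) := by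
  -- the `β`-columns of `g'⁻¹ g` are those of `g'⁻¹ g'  = 1`
  have hinv : ∀ (i : α ⊕ β) (b : β), (((g'⁻¹ * g : UForm α β) : GL (α ⊕ β) ℂ) : Matrix (α ⊕ β) (α ⊕ β) ℂ) i (Sum.inr b) =
      (1 : Matrix (α ⊕ β) (α ⊕ β) ℂ) i (Sum.inr b) := by
    intro i b
    have hone : (((g'⁻¹ * g' : UForm α β) : GL (α ⊕ β) ℂ) : Matrix (α ⊕ β) (α ⊕ β) ℂ) = 1 := by
      rw [inv_mul_cancel, UForm.coe_one]
    rw [← hone, UForm.coe_mul, UForm.coe_mul, Matrix.mul_apply, Matrix.mul_apply]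
    exact Finset.sum_congr rfl fun k _ => by rw [hcol k b]
  obtain ⟨u, hu⟩ := exists_eq_kV_of_inr_cols_eq_one (g'⁻¹ * g) hinv
  exact ⟨u, by rw [← hu, mul_inv_cancel_left]⟩

end Stabiliser

end RealDualPair

end Literature.RepresentationTheory.KonnoKonno2007

end
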